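import Mathlib
import HarnessLib
import Summits.Ventures.LatticeQCDFlow.Exactness.SphereIndependenceSamplerTV
import Summits.Ventures.LatticeQCDFlow.Exactness.SphereLOFlowEffectiveActionConcentration
import Summits.Ventures.LatticeQCDFlow.Exactness.SphereFlowDecorrelation

/-!
# The acceptance–footprint law on the lattice of spheres: the Gibbs law's correlations beyond the light cone are paid for by rejections, `|Cov_{e^{−cS}π̄/Z_c}(A, B)| ≤ 6ab(1 − acc) + 2τ_m(ℓ_A b + aℓ_B)` for the exact leading-order flow sampler

HONEST FRAMING: exact (Metropolis-corrected) sampling algorithms for lattice gauge theory;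
figures of merit are autocorrelation/cost numbers at stated couplings and volumes; no
continuum-physics claim.

Venture `LatticeQCDFlow` (cell pub-lqcd), topic `Exactness`; FANOUT row 7 (`s0-cpn-null`: the
S0-D1 rung — 2D CP⁹, Lüscher's LO trivializing map inside HMC, Engel–Schaefer 2011).  NEW WORK of
the cell over this leg's `Exactness/SphereIndependenceSamplerTV.lean` (acceptance controls total
variation and covariances), `Exactness/SphereFlowDecorrelation.lean` (the flowed uniform law
decorrelates beyond the cone), `Exactness/SphereLOFlowEffectiveActionConcentration.lean`
(continuity of `S_eff`) and GEN-15's `Exactness/SphereFlowLiouvilleMeasure.lean`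
(`(Φ_{0→c})_*(π̄.tilted(−S_eff)) = π̄.tilted(−cS)`: the target of the sampler in flowed coordinates IS
the Gibbs law); nothing is cited as a fact.  Printed counterpart, NAMED ONLY: the venture
statement's T9 (`StatementLocality.lean`, lean-2/theory-1
`TrivializingMaps/TruncatedFlowAcceptanceFootprint.lean`: the acceptance–footprint law for the
truncated Wilson-flow samplers on `SU(n)^E`).  THIS FILE is the sphere-side law for the exact
leading-order flow of the lattice CP(N−1)/O(N) action.

## Setting

E–S action (`d ≥ 2`, no self-coupling, adjoint pairs, local weight `≤ υ`, `υ ≥ 0`), `0 ≤ c ≤ |T| + 1`;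
`S_eff = c·S∘Φ_{0→c} − ℓ_{0→c}`; `acc` the mean Metropolis acceptance of the independence sampler
proposing `Φ_{0→c}(ω')`, `ω' ∼ π̄` (target `π̄.tilted(−S_eff)` in flowed coordinates); `K = 3|κ|υ/(d−1)`,
`τ_m = 2e^{Kc}(Kc)^{m+1}/(m+1)!`; observables `A`, `B` continuous, bounded by `a`, `b` on `Ω̃`,
footprints `S_A`, `S_B` with sup-Lipschitz moduli `ℓ_A`, `ℓ_B`, radius-`m` read-set neighbourhoods
(`N n = {n} ∪ couplingNbhd U n`) disjoint.

## Content

* **`abs_cov_gibbs_le_of_meanAccept`** — `|∫AB dγ_c − ∫A dγ_c·∫B dγ_c| ≤ 6ab·(1 − acc) + 2τ_m·(ℓ_A b + aℓ_B)`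
  for the GIBBS LAW `γ_c = π̄.tilted(−cS)`: at fixed flow time the rejection rate is bounded BELOW by the
  Gibbs correlations beyond the cone, `1 − acc ≥ (|Cov_{γ_c}(A,B)| − 2τ_m(ℓ_A b + aℓ_B))/(6ab)`, IN
  EVERY VOLUME — the locality barrier for this sampler, complementing the floor
  `acc ≥ exp(−(|Λ|D²/8 + D√(|Λ|/8)))` of `SphereLOFlowAcceptance`.

NOT CLAIMED: any value of a correlation length of `γ_c` (model-specific input, not typed);
autocorrelations; the one-step map of the rung; numbers.
-/

noncomputable section

namespace Summit.Ventures.LatticeQCDFlow.Exactness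

open Function Set Metric MeasureTheory NormedSpace InnerProductSpace
open scoped RealInnerProductSpace Topology Nat

variable {Λ : Type*} {E : Type*} [NormedAddCommGroup E] [InnerProductSpace ℝ E]
  [FiniteDimensional ℝ E] [Fintype Λ] [DecidableEq Λ] [MeasurableSpace E] [BorelSpace E] [Nontrivial E]

/-! ## §2 The acceptance–footprint law for the exact leading-order flow sampler -/

section LO

variable {U : Λ → Λ → (E →L[ℝ] E)} {T : ℝ}

/-- **THE ACCEPTANCE–FOOTPRINT LAW ON THE LATTICE OF SPHERES.**  For the E–S action (`d ≥ 2`, no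
self-coupling, adjoint pairs, local weight `≤ υ`, `υ ≥ 0`) and `0 ≤ c ≤ |T| + 1`, let `acc` be the
mean Metropolis acceptance of the independence sampler that proposes `Φ_{0→c}(ω')`, `ω' ∼ π̄`, for the
Gibbs target `γ_c = π̄.tilted(−cS)` (in flowed coordinates: target `π̄.tilted(−S_eff)`,
`S_eff = c·S∘Φ_{0→c} − ℓ_{0→c}`).  Then for continuous observables `A`, `B` bounded by `a`, `b` on `Ω̃`
with footprints `S_A`, `S_B`, sup-Lipschitz moduli `ℓ_A`, `ℓ_B`, and disjoint radius-`m` read-set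
neighbourhoods (`N n = {n} ∪ couplingNbhd U n`):
`|∫AB dγ_c − ∫A dγ_c·∫B dγ_c| ≤ 6ab·(1 − acc) + 2τ_m·(ℓ_A b + aℓ_B)`,
`τ_m = 2e^{Kc}(Kc)^{m+1}/(m+1)!`, `K = 3|κ|υ/(d−1)` — THE GIBBS CORRELATIONS BEYOND THE CONE ARE PAID
FOR BY REJECTIONS, in every volume. -/
theorem abs_cov_gibbs_le_of_meanAccept (hU0 : ∀ n, U n n = 0)
    (hUadj : ∀ m n (v w : E), ⟪U m n v, w⟫ = ⟪v, U n m w⟫) (hd : 2 ≤ Module.finrank ℝ E)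
    (κ S₀ : ℝ) {υ : ℝ} (hυ : ∀ k, ∑ m, ‖U k m‖ ≤ υ) (hυ0 : 0 ≤ υ) {c : ℝ} (hc0 : 0 ≤ c)
    (hc : c ≤ |T| + 1) (m : ℕ)
    {A B : (Λ → E) → ℝ} (hAc : Continuous A) (hBc : Continuous B) {SA SB : Set Λ}
    {a b ℓA ℓB : ℝ} (hAa : ∀ x : Λ → E, (∀ n, ‖x n‖ = 1) → |A x| ≤ a)
    (hBb : ∀ x : Λ → E, (∀ n, ‖x n‖ = 1) → |B x| ≤ b)
    (hAℓ : ∀ x y : Λ → E, (∀ n, ‖x n‖ = 1) → (∀ n, ‖y n‖ = 1) → ∀ η : ℝ,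
      (∀ i ∈ SA, ‖x i - y i‖ ≤ η) → |A x - A y| ≤ ℓA * η)
    (hBℓ : ∀ x y : Λ → E, (∀ n, ‖x n‖ = 1) → (∀ n, ‖y n‖ = 1) → ∀ η : ℝ,
      (∀ i ∈ SB, ‖x i - y i‖ ≤ η) → |B x - B y| ≤ ℓB * η)
    (hsep : Disjoint (⋃ i ∈ SA, nball (fun n => insert n (couplingNbhd U n)) m i)
      (⋃ j ∈ SB, nball (fun n => insert n (couplingNbhd U n)) m j)) :
    |∫ ω, A (fun n => ((ω : Λ → sphere (0 : E) 1) n : E)) * B (fun n => (ω n : E))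
          ∂(Measure.pi (fun _ : Λ => uniformSphere (volume : Measure E))).tilted
            (fun ω => -(c * esAction κ S₀ U (fun n => (ω n : E)))) -
        (∫ ω, A (fun n => ((ω : Λ → sphere (0 : E) 1) n : E))
            ∂(Measure.pi (fun _ : Λ => uniformSphere (volume : Measure E))).tilted
              (fun ω => -(c * esAction κ S₀ U (fun n => (ω n : E))))) *
          ∫ ω, B (fun n => ((ω : Λ → sphere (0 : E) 1) n : E))
            ∂(Measure.pi (fun _ : Λ => uniformSphere (volume : Measure E))).tilted
              (fun ω => -(c * esAction κ S₀ U (fun n => (ω n : E))))| ≤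
      6 * (a * b) * (1 - ∫ ω, (∫ ω', min 1 (Real.exp
          ((c * esAction κ S₀ U (sphereTDFlow (G := fun _ : ℝ => loFlowAction κ S₀ U)
              (contDiff_const_family (contDiff_loFlowAction U κ S₀)) T 0 c
                (fun m => ((ω : Λ → sphere (0 : E) 1) m : E))) -
            sphereTDFlowLogJac (G := fun _ : ℝ => loFlowAction κ S₀ U)
              (contDiff_const_family (contDiff_loFlowAction U κ S₀)) T 0 c (fun m => (ω m : E))) -
          (c * esAction κ S₀ U (sphereTDFlow (G := fun _ : ℝ => loFlowAction κ S₀ U)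
              (contDiff_const_family (contDiff_loFlowAction U κ S₀)) T 0 c
                (fun m => ((ω' : Λ → sphere (0 : E) 1) m : E))) -
            sphereTDFlowLogJac (G := fun _ : ℝ => loFlowAction κ S₀ U)
              (contDiff_const_family (contDiff_loFlowAction U κ S₀)) T 0 c (fun m => (ω' m : E)))))
          ∂Measure.pi (fun _ : Λ => uniformSphere (volume : Measure E)))
        ∂(Measure.pi (fun _ : Λ => uniformSphere (volume : Measure E))).tilted (fun ω =>
          -(c * esAction κ S₀ U (sphereTDFlow (G := fun _ : ℝ => loFlowAction κ S₀ U)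
              (contDiff_const_family (contDiff_loFlowAction U κ S₀)) T 0 c (fun m => (ω m : E))) -
            sphereTDFlowLogJac (G := fun _ : ℝ => loFlowAction κ S₀ U)
              (contDiff_const_family (contDiff_loFlowAction U κ S₀)) T 0 c (fun m => (ω m : E))))) +
        2 * (2 * Real.exp (3 * |κ| * υ / ((Module.finrank ℝ E : ℝ) - 1) * c) *
            (3 * |κ| * υ / ((Module.finrank ℝ E : ℝ) - 1) * c) ^ (m + 1) / ((m + 1)! : ℝ)) *
          (ℓA * b + a * ℓB) := by
  set μ : Measure (Λ → sphere (0 : E) 1) := Measure.pi (fun _ : Λ => uniformSphere (volume : Measure E))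
    with hμ
  have hG2 := contDiff_const_family (Λ := Λ) (contDiff_loFlowAction U κ S₀ (m := 2))
  set Φ : (Λ → E) → (Λ → E) := sphereTDFlow (G := fun _ : ℝ => loFlowAction κ S₀ U)
    (contDiff_const_family (contDiff_loFlowAction U κ S₀)) T 0 c with hΦ
  set F : (Λ → sphere (0 : E) 1) → ℝ := fun ω =>
    c * esAction κ S₀ U (Φ (fun m => (ω m : E))) -
      sphereTDFlowLogJac (G := fun _ : ℝ => loFlowAction κ S₀ U)
        (contDiff_const_family (contDiff_loFlowAction U κ S₀)) T 0 c (fun m => (ω m : E)) with hF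
  have hFc : Continuous F := continuous_effAction_loFlow (U := U) κ S₀ c (T := T)
  -- the observables in flowed coordinates
  set X : (Λ → sphere (0 : E) 1) → ℝ := fun ω => A (Φ (fun n => (ω n : E))) with hX
  set Y : (Λ → sphere (0 : E) 1) → ℝ := fun ω => B (Φ (fun n => (ω n : E))) with hY
  have hΦc : Continuous Φ := (contDiff_sphereTDFlow_apply _ 0 c (T := T)).continuous
  have hXc : Continuous X := hAc.comp (hΦc.comp continuous_sphereConfig)
  have hYc : Continuous Y := hBc.comp (hΦc.comp continuous_sphereConfig)
  have hΦ1 : ∀ ω : Λ → sphere (0 : E) 1, ∀ n, ‖Φ (fun n => (ω n : E)) n‖ = 1 :=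
    fun ω n => norm_sphereTDFlow_eq_one _ 0 (norm_sphereConfig_eq_one ω) c n
  have hXa : ∀ ω, |X ω| ≤ a := fun ω => hAa _ (hΦ1 ω)
  have hYb : ∀ ω, |Y ω| ≤ b := fun ω => hBb _ (hΦ1 ω)
  -- (1) Gibbs expectations are target expectations in flowed coordinates
  have hc' : |c| ≤ |T| + 1 := by rwa [abs_of_nonneg hc0]
  have h0 : |(0 : ℝ)| ≤ |T| + 1 := by rw [abs_zero]; positivity
  have hmap := map_sphereTDFlowMap_tilted_effAction (G := fun _ : ℝ => loFlowAction κ S₀ U)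
    (contDiff_const_family (contDiff_loFlowAction U κ S₀))
    (contDiff_const_family (contDiff_loFlowAction U κ S₀)) (contDiff_esAction U κ S₀) c h0 hc' (T := T)
  have htilt : μ.tilted (fun ω => -F ω) = μ.tilted (fun ω =>
      sphereTDFlowLogJac (G := fun _ : ℝ => loFlowAction κ S₀ U)
        (contDiff_const_family (contDiff_loFlowAction U κ S₀)) T 0 c (fun m => (ω m : E)) -
      c * esAction κ S₀ U (Φ (fun m => (ω m : E)))) := by
    congr 1; funext ω; simp only [hF]; ring
  have hgibbs : ∀ {g : (Λ → E) → ℝ}, Continuous g →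
      ∫ ω, g (fun n => ((ω : Λ → sphere (0 : E) 1) n : E)) ∂μ.tilted
          (fun ω => -(c * esAction κ S₀ U (fun n => (ω n : E)))) =
        ∫ ω, g (Φ (fun n => (ω n : E))) ∂μ.tilted (fun ω => -F ω) := by
    intro g hg
    have hgc : Continuous fun ω : Λ → sphere (0 : E) 1 => g (fun n => (ω n : E)) :=
      hg.comp continuous_sphereConfig
    rw [htilt, hμ, ← hmap, integral_map (measurable_sphereTDFlowMap _ T 0 c).aemeasurable
      hgc.aestronglyMeasurable]
    simp only [coe_sphereTDFlowMap_eq, hΦ]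
  rw [hgibbs (g := fun x => A x * B x) (hAc.mul hBc), hgibbs hAc, hgibbs hBc]
  -- (2) acceptance controls the change of covariance; (3) the flowed law decorrelates
  have h1 := abs_cov_tilted_sub_cov_le hFc hXc hYc hXa hYb
  have h2 := abs_cov_comp_loFlow_le hU0 hUadj hd κ S₀ hυ hυ0 0 c m hAc hBc hAa hBb hAℓ hBℓ hsep (T := T)
  rw [sub_zero, abs_of_nonneg hc0] at h2
  have h3 := abs_sub_le
    (∫ ω, X ω * Y ω ∂μ.tilted (fun ω => -F ω) -
      (∫ ω, X ω ∂μ.tilted (fun ω => -F ω)) * ∫ ω, Y ω ∂μ.tilted (fun ω => -F ω))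
    (∫ ω, X ω * Y ω ∂μ - (∫ ω, X ω ∂μ) * ∫ ω, Y ω ∂μ) 0
  rw [sub_zero] at h3
  simp only [sub_zero] at h3
  exact h3.trans (add_le_add h1 h2)

end LO

end Summit.Ventures.LatticeQCDFlow.Exactness

end
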